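/-
Copyright (c) 2026 the pub-hodgecm-mathlib formalisation cell (harness21).  Prover seat hodgecm-mathlib-K2Liu-p05 (g6), Track B «K2-LIT»,
#184♮ = hLiu418 = `stmt-HodgeConjecture-24832`; #42S organ S2, S2-asm road (γ): a frame-currency letter of ★ `K2LiuArchSWSpanningInstance` (binders `hk2`∕`hfr2`)
and of the (law) dictionary `K2LiuArchSiegelCharacterTube` (F0P2-p08 (g0)); S2 desk K2Liu-p05 (g6), LEAD F0P6-plan (g14) BATCH #45.
-/
import Summits.HodgeConjecture.HodgeConjecture.Theorems.K2LiuSiegelMainOrbitOpenEmbeddingArchPrelims   -- ★ `isSiegelDelta_archToAdelic_iff`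
import HarnessLib

/-!
# Crux `HLiu418`, S2-asm road (γ): THE SIEGEL CONDITION OF AN ARCHIMEDEAN SLICE — `archPiEquivCM⁻¹ u ∈ P_Δ ↔ ∀ w, u_w ∈ P_Δ(ℂ)`, and for a one-place slice
# `archPiEquivCM⁻¹ (δ_w g) ∈ P_Δ ↔ g ∈ P_Δ(ℂ)` (the matrix condition ★ `IsSiegelM` at the place `w`)

Cell `hodgecm-mathlib`, crux item hLiu418 = `stmt-HodgeConjecture-24832`; squad K2 ∕ K2Liu; prover K2Liu-p05 (g6) (S2 desk).
THEOREMS ONLY (no `def`, no `instance`, no notation, no named-fact hypothesis, no `sorry`); lane `--supports stmt-HodgeConjecture-24832 --as helper`.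

WHY.  The packaging ★ `archSWRegionSpanning_of_readings_on` carries `hk2`∕`hfr2`: «every `g ∈ archLocal w` is `p · fr_w u` with `IsSiegelDelta (archToAdelic (archPiEquivCM⁻¹ (δ_w p)))`»,
and the (law) dictionary needs «tube-Siegel `P` ⇒ `IsSiegelDelta` of the slice of `ι_w P`».  Both read the GLOBAL predicate ★ `IsSiegelDelta` (the `Δ`-row relation
`h₁₁ + h₁₂ = h₂₁ + h₂₂` of the adelic matrix) on a purely archimedean element supported at one place.  ★ `isSiegelDelta_archToAdelic_iff` reduces it to ★ `IsSiegelM` of the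
matrix over the mixed space `L ⊗ ℝ = Π_w ℂ` (no real places: `L` is CM); this file reads that matrix condition place by place (`coe_archPiEquiv_symm_apply` is `rfl`):
* `mixedSpace_eq_iff` — two elements of the mixed space of a totally complex field agree iff their complex coordinates agree;
* `isSiegelM_mixed_iff` — `IsSiegelM` over `Π_w ℂ` ↔ `IsSiegelM` of every coordinate matrix;
* **`isSiegelDelta_archPiEquivCM_symm_iff`** — `IsSiegelDelta (archToAdelic (archPiEquivCM⁻¹ u)) ↔ ∀ w, IsSiegelM (u w)`;
* `isSiegelM_one`, **`isSiegelDelta_archPiEquivCM_symm_mulSingle_iff`** — the one-place slice: `↔ IsSiegelM (g : M_{2n}(ℂ))`.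
References: [GelbartRogawski1991] §3.1; [BorelJacquet1979] §4.1; [HarrisKudlaSweet1996] §1 (1.11).
HONEST LABEL.  Count-neutral helper: `HC_CM` is proved only modulo the 7 printed citations (2 remaining named inputs: hLiu418 = `stmt-HodgeConjecture-24832`,
h413 = `stmt-HodgeConjecture-24833`) until rung 0 closes; this file closes no socket.
-/

set_option autoImplicit false
set_option linter.dupNamespace false -- the mandated namespace repeats `HodgeConjecture.HodgeConjecture`

noncomputable section

open scoped Classical Matrix
open NumberField NumberField.InfinitePlace NumberField.mixedEmbedding IsDedekindDomain
open Literature.NumberTheory.Automorphic Literature.NumberTheory.Automorphic.UnitaryGroup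
open Literature.NumberTheory.GelbartRogawski1991 Literature.NumberTheory.GelbartRogawski1991.GRConstruction
open Literature.NumberTheory.GelbartRogawski1991.UnitaryDualPair
open Summit.HodgeConjecture.HodgeConjecture.Cruxes.HLiu418.K2LiuSiegelMainOrbitOpenEmbeddingArchPrelims

namespace Summit.HodgeConjecture.HodgeConjecture.Cruxes.HLiu418.K2LiuArchSliceSiegel

variable (L : Type) [Field L] [NumberField L] [IsCMField L]
variable {N M n : ℕ} (e : Fin N × Fin M ≃ Fin n)
  (dV : Fin N → L) (hdV : ∀ i, IsCMField.complexConj L (dV i) = dV i)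
  (dW : Fin M → L) (hdW : ∀ i, IsCMField.complexConj L (dW i) = dW i)

/-! ## §1 The mixed space of a CM field, coordinate by coordinate -/

/-- a CM field has no real place. [folklore] -/
theorem isEmpty_isReal : IsEmpty {v : InfinitePlace L // v.IsReal} :=
  ⟨fun v => (not_isReal_iff_isComplex.2 (IsTotallyComplex.isComplex v.1)) v.2⟩

/-- **two elements of the mixed space `L ⊗ ℝ = Π_w ℂ` agree iff their complex coordinates agree** (no real coordinates). [folklore] -/
theorem mixedSpace_eq_iff (x y : mixedSpace L) : x = y ↔ ∀ w : {w : InfinitePlace L // w.IsComplex}, x.2 w = y.2 w := by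
  constructor
  · rintro rfl w
    rfl
  · intro h
    haveI := isEmpty_isReal L
    exact Prod.ext (funext fun v => isEmptyElim v) (funext h)

/-- **`IsSiegelM` OVER `Π_w ℂ` IS `IsSiegelM` COORDINATE BY COORDINATE**: for a matrix `A` over the mixed space, the `Δ`-row relation holds iff it holds for every
coordinate matrix `(A · ·).2 w`. [cite: GelbartRogawski1991, §3.1] -/
theorem isSiegelM_mixed_iff (A : Matrix (Fin (n + n)) (Fin (n + n)) (mixedSpace L)) :
    IsSiegelM (n := n) A ↔ ∀ w : {w : InfinitePlace L // w.IsComplex}, IsSiegelM (n := n) (A.map fun x : mixedSpace L => x.2 w) := by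
  simp only [IsSiegelM, ← Matrix.ext_iff, Matrix.add_apply, Matrix.toBlocks₁₁, Matrix.toBlocks₁₂, Matrix.toBlocks₂₁, Matrix.toBlocks₂₂, Matrix.reindex_apply,
    Matrix.submatrix_apply, Matrix.of_apply, Matrix.map_apply, mixedSpace_eq_iff, Prod.snd_add, Pi.add_apply]
  exact ⟨fun h w i j => h i j w, fun h i j w => h w i j⟩

/-- the coordinate matrices of `archPiEquivCM⁻¹ u` are the `u w` (`coe_archPiEquiv_symm_apply`, `rfl`). [cite: BorelJacquet1979, §4.1] -/
theorem map_snd_archPiEquivCM_symm (u : ∀ w : {w : InfinitePlace L // w.IsComplex}, archLocal L (n + n) (hermD L e dV hdV dW hdW) w)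
    (w : {w : InfinitePlace L // w.IsComplex}) :
    ((((archPiEquivCM (n + n) L (hermD L e dV hdV dW hdW)).symm u : arch (Fp L) L (IsCMField.complexConj L) (n + n) (hermD L e dV hdV dW hdW)) :
        GL (Fin (n + n)) (mixedSpace L)) : Matrix (Fin (n + n)) (Fin (n + n)) (mixedSpace L)).map (fun x : mixedSpace L => x.2 w) =
      (((u w : archLocal L (n + n) (hermD L e dV hdV dW hdW) w) : GL (Fin (n + n)) ℂ) : Matrix (Fin (n + n)) (Fin (n + n)) ℂ) :=
  Matrix.ext fun _ _ => rfl

/-! ## §2 The Siegel condition of an archimedean slice -/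

/-- **`archPiEquivCM⁻¹ u ∈ P_Δ(𝔸)` IFF `u_w ∈ P_Δ(ℂ)` AT EVERY COMPLEX PLACE** (★ `isSiegelDelta_archToAdelic_iff` + §1). [cite: GelbartRogawski1991, §3.1] [cite: BorelJacquet1979, §4.1] -/
theorem isSiegelDelta_archPiEquivCM_symm_iff (u : ∀ w : {w : InfinitePlace L // w.IsComplex}, archLocal L (n + n) (hermD L e dV hdV dW hdW) w) :
    IsSiegelDelta L e dV hdV dW hdW (archToAdelic (Fp L) L (IsCMField.complexConj L) (n + n) (hermD L e dV hdV dW hdW)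
        ((archPiEquivCM (n + n) L (hermD L e dV hdV dW hdW)).symm u)) ↔
      ∀ w : {w : InfinitePlace L // w.IsComplex},
        IsSiegelM (n := n) ((((u w : archLocal L (n + n) (hermD L e dV hdV dW hdW) w) : GL (Fin (n + n)) ℂ) : Matrix (Fin (n + n)) (Fin (n + n)) ℂ)) := by
  rw [isSiegelDelta_archToAdelic_iff, isSiegelM_mixed_iff]
  refine forall_congr' fun w => ?_
  rw [map_snd_archPiEquivCM_symm]

/-- `1 ∈ P_Δ(ℂ)`. [folklore] -/
theorem isSiegelM_one {R : Type*} [NonAssocSemiring R] : IsSiegelM (n := n) (1 : Matrix (Fin (n + n)) (Fin (n + n)) R) := by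
  unfold IsSiegelM
  rw [Matrix.reindex_apply, Matrix.submatrix_one_equiv, ← Matrix.fromBlocks_one, Matrix.toBlocks_fromBlocks₁₁, Matrix.toBlocks_fromBlocks₁₂,
    Matrix.toBlocks_fromBlocks₂₁, Matrix.toBlocks_fromBlocks₂₂, add_zero, zero_add]

/-- **THE ONE-PLACE SLICE**: `archPiEquivCM⁻¹ (δ_w g) ∈ P_Δ(𝔸) ↔ g ∈ P_Δ(ℂ)` (`IsSiegelM` of the matrix of `g`; the other coordinates are `1 ∈ P_Δ`).  This is the currency of
the packaging's `hk2`∕`hfr2` and of the (law) dictionary's companion. [cite: GelbartRogawski1991, §3.1] [cite: BorelJacquet1979, §4.1] -/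
theorem isSiegelDelta_archPiEquivCM_symm_mulSingle_iff (w : {w : InfinitePlace L // w.IsComplex}) (g : archLocal L (n + n) (hermD L e dV hdV dW hdW) w) :
    IsSiegelDelta L e dV hdV dW hdW (archToAdelic (Fp L) L (IsCMField.complexConj L) (n + n) (hermD L e dV hdV dW hdW)
        ((archPiEquivCM (n + n) L (hermD L e dV hdV dW hdW)).symm (Pi.mulSingle w g))) ↔
      IsSiegelM (n := n) (((g : archLocal L (n + n) (hermD L e dV hdV dW hdW) w) : GL (Fin (n + n)) ℂ) : Matrix (Fin (n + n)) (Fin (n + n)) ℂ) := by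
  rw [isSiegelDelta_archPiEquivCM_symm_iff]
  constructor
  · intro h
    have hw := h w
    rwa [Pi.mulSingle_eq_same] at hw
  · intro h w'
    by_cases hw : w' = w
    · subst hw
      rwa [Pi.mulSingle_eq_same]
    · rw [Pi.mulSingle_eq_of_ne hw]
      exact isSiegelM_one

/-- **… IN TUBE-FRAME LETTERS**: for a frame `(T, Tinv)` at `w` with the parabolic clause «`IsSiegelM g → (T g̃ Tinv)₂₁ = 0`» AND ITS CONVERSE (binder `hconv`; ★ frame packages
export the direct clause (iv)), the slice of `g` is in `P_Δ(𝔸)` iff its tube image is tube-Siegel. [cite: GelbartRogawski1991, §3.1] [cite: Shimura1997, §6] -/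
theorem isSiegelDelta_archPiEquivCM_symm_mulSingle_iff_toBlocks₂₁ (w : {w : InfinitePlace L // w.IsComplex}) (T Tinv : Matrix (Fin n ⊕ Fin n) (Fin n ⊕ Fin n) ℂ)
    (hdir : ∀ g : archLocal L (n + n) (hermD L e dV hdV dW hdW) w, IsSiegelM (n := n) ((g : GL (Fin (n + n)) ℂ) : Matrix (Fin (n + n)) (Fin (n + n)) ℂ) →
      (T * Matrix.reindex (e₂ (n := n)).symm (e₂ (n := n)).symm ((g : GL (Fin (n + n)) ℂ) : Matrix (Fin (n + n)) (Fin (n + n)) ℂ) * Tinv).toBlocks₂₁ = 0)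
    (hconv : ∀ g : archLocal L (n + n) (hermD L e dV hdV dW hdW) w,
      (T * Matrix.reindex (e₂ (n := n)).symm (e₂ (n := n)).symm ((g : GL (Fin (n + n)) ℂ) : Matrix (Fin (n + n)) (Fin (n + n)) ℂ) * Tinv).toBlocks₂₁ = 0 →
      IsSiegelM (n := n) ((g : GL (Fin (n + n)) ℂ) : Matrix (Fin (n + n)) (Fin (n + n)) ℂ))
    (g : archLocal L (n + n) (hermD L e dV hdV dW hdW) w) :
    IsSiegelDelta L e dV hdV dW hdW (archToAdelic (Fp L) L (IsCMField.complexConj L) (n + n) (hermD L e dV hdV dW hdW)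
        ((archPiEquivCM (n + n) L (hermD L e dV hdV dW hdW)).symm (Pi.mulSingle w g))) ↔
      (T * Matrix.reindex (e₂ (n := n)).symm (e₂ (n := n)).symm ((g : GL (Fin (n + n)) ℂ) : Matrix (Fin (n + n)) (Fin (n + n)) ℂ) * Tinv).toBlocks₂₁ = 0 := by
  rw [isSiegelDelta_archPiEquivCM_symm_mulSingle_iff]
  exact ⟨hdir g, hconv g⟩

end Summit.HodgeConjecture.HodgeConjecture.Cruxes.HLiu418.K2LiuArchSliceSiegel

end
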